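import Summits.QuantumFields.BalabanUV.Beta.FP.TorusCompositeCovarianceTwoPolar

/-!
# `BalabanUV.Beta.FP.TorusCompositeNestedJets` — road «FP» for binder row D1, ROUTE T: **THE DOOR's NESTED `Q`-JETS ARE THE COMPOSITE JETS ONE STOREY UP** —
# #21 ∕ #41d's namings `𝔔₀ = Q₂₀ * Q₁₀`, `𝔔₁f v = Q₂₁f v * Q₁₀ + Q₂₀ * Q₁₁f v`, `𝔔₂f v v′ = Q₂₂f v v′ * Q₁₀ + Q₂₁f v * Q₁₁f v′ + (Q₂₁f v * Q₁₁f v′ + Q₂₀ * Q₁₂f v v′)`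
# (`TowerLawFullIndex` :138–140), AT THE RECORD BINDINGS of this lineage's ♭ tower with the top multipliers' slot presentation read as the next storey's
# (`(κ, pμ′, mμ′) := (pbox M × Fin (d+1), coarsePt M Lc ·.1, ·.2)`, `M′ := fine Lc M`), ARE `compRows ∕ c • compIns₁ ∕ c² • compIns₂₂` ONE STOREY UP (order 2 after
# symmetrisation) — so the `N`-system's (S3-2) Q-sockets read through R-9 ∕ R-10 ∕ R-11 at depth `n+2` exactly as the `F`-system's do at depth `n+1`

WHY.  #42a `TowerKernelLaw` binds the `N`-system's Q-jets on the dressed jets `𝔔′₁f ∕ 𝔔′₂f` whose undressed summands are `𝔔₁f ∕ 𝔔₂f` above (leaf-02 g29 P-1,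
HOME/CLAIMS.log l.55302); #42b `StepRecursionFeedNested` transports the storey below's `N` system into the next storey's `F` system.  At the record
(`TorusCompositeCovarianceOneRows.torus_d1_tower`, `TorusCompositeCovarianceTwoRows.torus_d2_tower`, `TorusCompositeRowsDirectional`): `Q₁₀ := compRows Lc M′ lev rs (n+1)`,
`Q₂₀ := (perF M′ (bhKStepAt d (toSite (rs 0)) Lc (lev 0))).submatrix (slots) (ff)` (= `Qstep` at the next storey's slots, `rfl`), `Q₁₁f v := c • compIns₁ … (hv v)`,
`Q₁₂f v v′ := c² • compIns₂₂ … (hv v) (hv v′)`, `Q₂₁f v := Σ_{a′} ((c·θ)·(Q₁₀ *ᵥ hv v) a′) • (perF M′ (dper M′ (vhSAt (toSite (rs 0)) … a′)))|slots,ff` (`θ = Lc^{d+1}·stepScale d Lc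
(lev 0) ∕ σ_{n+1}`), `Q₂₂f v v′ := (Lc^{d+1}·stepScale d Lc (lev 0))⁻¹ • Σ_{b,b′} ((cθ)(Q₁₀ *ᵥ hv v) b)((cθ)(Q₁₀ *ᵥ hv v′) b′) • (perF M′ (dper M′ (½-symmetrised relative
period sum of vh₂SAt)))|slots,ff`.  In THIS file the nested tower is indexed as OUR composites are (`TorusCompositeCovarianceOne.compIns₁`: top step at `lev 1 ∕ rs 1`,
lower storeys `fun k => lev (k+1)`): the record's `lev 0 ∕ rs 0 ∕ lev (i+1)` are this file's `lev 1 ∕ rs 1 ∕ lev (i+1+1)` (instantiate `lev := fun k => lev_rec (k − 1)`).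
THEN (§1) `Q₂₁(w) * compRows′ + Qstep * (c • compIns₁′ w) = c • compIns₁ Lc M lev rs (n+1) w` (`compIns₁_succ` + `stepIns₁_smul`), (§2) `½ • (𝔔₂(w, w′) + 𝔔₂(w′, w))
= c² • compIns₂₂ Lc M lev rs (n+1) w w′` (`compIns₂₂_succ` + `stepIns₂₂_smul ∕ _comm` + `compIns₂₂_comm`; the record's unit `(Lc^{d+1}s)⁻¹·(cθ)² = c²·θ∕σ` is the
bi-jet's), (§0) `Q₂₀ * Q₁₀ = compRows Lc M lev rs (n+1)` (`rfl`).  [folklore] matrix algebra BY NAME over OUR bookkeeping objects; no `def`, no `def … : Prop`,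
nothing cited, 0 sorry; NO chart; nothing of Bałaban's asserted.  NOT HERE: the dressing words of `𝔔′₁f ∕ 𝔔′₂f` ((COV-m), an2's), the field–field jets, (TAB).

HONEST DEPENDENCY (page 1, mandatory): continuum YM on T⁴ ⇐ BetaPertH ∧ nine spine estimates (0/9 proved); BetaPertH ⇐ (D1) ∧ (D4) ∧ CAP+tail;
G-an2-4 gates asym, D1 and NE2/3/4.  HONEST FRAMING (cell contract, verbatim): «discharging `BetaPertH` makes Bałaban's UV stability UNCONDITIONAL —
a real constructive-QFT result; it is NOT the continuum limit and NOT the Clay problem.»  ABSOLUTE RULE (cell charter, verbatim): «No internally-minted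
statement may enter as a cited fact. Every hypothesis is either kernel-proved in this package or a verbatim quotation of a PUBLISHED theorem with page
reference. The manuscript(s) under audit are NOT citable for their own disputed steps — they are the thing under adjudication; programme-internal
(2001/route/tribunal) claims are never citable.»  0 estimates; 0∕4 row-D1 binders (hW, hR, D1Tel, D1Rep); NOT (T-ID), NOT (C1), NOT SDF, NOT D1,
NOT BetaPertH, NOT continuum, NOT Clay.  D1 formalisation swarm LEAF PROVER 02 (b2b-balaban-beta-d1-formalise-leaf-02 gen 29), 2026-08-23.  No existing file touched.
-/

noncomputable section

open scoped BigOperators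

namespace Summit.QuantumFields.BalabanUV.Beta.FP.TorusCompositeNestedJets

open Matrix Finset
open Literature.MathematicalPhysics.QuantumFieldTheory
open Literature.MathematicalPhysics.QuantumFieldTheory.Balaban1983to89
open Literature.MathematicalPhysics.QuantumFieldTheory.Balaban1983to89.Beta
open ExpKernelCalculus (MKer)
open B4TorusKernel.MultiPeriod (translate)
open B5Prop11Plancherel (fine)
open B6Lemma24Torus (pbox)
open AffineAveraging (Site box toSite)
open AveragingHessianKernelsRooted (vhSAt)
open AveragingMixedJetTables (vh₂SAt)
open OneStepResolventKernel (Fib)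
open Summit.QuantumFields.BalabanUV.Beta.BorderedHessian (stepScale stepScale_ne_zero bhKStepAt)
open Summit.QuantumFields.BalabanUV.Beta.FP.KernelPeriodisationFib (Idx perF)
open Summit.QuantumFields.BalabanUV.Beta.FP.KernelPeriodisationFibLoc (dper)
open Summit.QuantumFields.BalabanUV.Beta.FP.TorusGaugeCovarianceCoarse (coarsePt)
open Summit.QuantumFields.BalabanUV.Beta.FP.TorusCompositeObjects (towerTorus Qstep compRows compRows_succ)
open Summit.QuantumFields.BalabanUV.Beta.FP.TorusCompositeCovarianceOne (stepIns₁ compIns₁)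
open Summit.QuantumFields.BalabanUV.Beta.FP.TorusCompositeIndexWardOne (stepIns₁_smul)
open Summit.QuantumFields.BalabanUV.Beta.FP.TorusCompositeCovarianceTwoPolar (stepIns₂₂ compIns₂₂ compIns₂₂_comm stepIns₂₂_smul_left
  stepIns₂₂_smul_right stepIns₂₂_comm)

variable {d : ℕ} (Lc : ℕ) [NeZero Lc]

/-! ## §0 Rows: `𝔔₀ = Q₂₀ * Q₁₀` is `compRows` one storey up -/

/-- [folklore] **ROWS**: at the next storey's slots, `Q₂₀ * Q₁₀ = Qstep Lc M (lev 1) (rs 1) * compRows Lc (fine Lc M) (lev∘succ) (rs∘succ) n = compRows Lc M lev rs (n+1)` (`rfl`). -/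
theorem nestedRows_eq_compRows (n : ℕ) (M : Fin (d + 1) → ℕ) [∀ μ, NeZero (M μ)] (lev : ℕ → ℕ) (rs : ℕ → (Fin (d + 1) → ℕ)) :
    (perF (fine Lc M) (bhKStepAt d (toSite (rs 1)) Lc (lev 1))).submatrix
        (fun a : ↥(pbox M) × Fin (d + 1) => ((coarsePt M Lc a.1, Sum.inr a.2) : Idx (fine Lc M) (Fib d)))
        (fun b : ↥(pbox (fine Lc M)) × Fin (d + 1) => ((b.1, Sum.inl b.2) : Idx (fine Lc M) (Fib d)))
      * compRows Lc (fine Lc M) (fun k => lev (k + 1)) (fun k => rs (k + 1)) n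
      = (compRows Lc M lev rs (n + 1) : Matrix (↥(pbox M) × Fin (d + 1)) (↥(pbox (towerTorus Lc (fine Lc M) n)) × Fin (d + 1)) ℝ) := rfl

/-! ## §1 Order 1: `𝔔₁f` is `c • compIns₁` one storey up -/

/-- [folklore] **ORDER 1 — `𝔔₁f v = Q₂₁f v * Q₁₀ + Q₂₀ * Q₁₁f v` IS `c • compIns₁` ONE STOREY UP**: with the record's `Q₂₁` (the top step's rooted member
along `(c·θ_n) • (compRows′ *ᵥ w)`, `θ_n = Lc^{d+1}·stepScale d Lc (lev 1) ∕ σ_n`) at the next storey's slots, `Q₁₀ := compRows′`, `Q₂₀ := Qstep`, `Q₁₁ w := c • compIns₁′ w`: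
`Q₂₁(w) * compRows′ + Qstep * (c • compIns₁′ w) = c • compIns₁ Lc M lev rs (n+1) w` (`compIns₁_succ`, `stepIns₁_smul`). -/
theorem nestedQ₁_eq_smul_compIns₁ (n : ℕ) (M : Fin (d + 1) → ℕ) [∀ μ, NeZero (M μ)] (lev : ℕ → ℕ) (rs : ℕ → (Fin (d + 1) → ℕ)) (c : ℝ)
    (w : ↥(pbox (towerTorus Lc (fine Lc M) n)) × Fin (d + 1) → ℝ) :
    (∑ a' : ↥(pbox (fine Lc M)) × Fin (d + 1),
        ((c * (((Lc : ℝ) ^ (d + 1) * stepScale d Lc (lev 1)) * (∏ i ∈ range n, (stepScale d Lc (lev (i + 1 + 1)) * ((box (d + 1) Lc).card : ℝ)))⁻¹))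
          * (compRows Lc (fine Lc M) (fun k => lev (k + 1)) (fun k => rs (k + 1)) n *ᵥ w) a') •
        (perF (fine Lc M) (dper (fine Lc M) (vhSAt (toSite (rs 1)) d Lc rfl a'.2 (a'.1 : Site (d + 1))))).submatrix
          (fun a : ↥(pbox M) × Fin (d + 1) => ((coarsePt M Lc a.1, Sum.inr a.2) : Idx (fine Lc M) (Fib d)))
          (fun b : ↥(pbox (fine Lc M)) × Fin (d + 1) => ((b.1, Sum.inl b.2) : Idx (fine Lc M) (Fib d))))
        * compRows Lc (fine Lc M) (fun k => lev (k + 1)) (fun k => rs (k + 1)) n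
      + Qstep Lc M (lev 1) (rs 1) * (c • compIns₁ Lc (fine Lc M) (fun k => lev (k + 1)) (fun k => rs (k + 1)) n w)
      = c • (compIns₁ Lc M lev rs (n + 1) w : Matrix (↥(pbox M) × Fin (d + 1)) (↥(pbox (towerTorus Lc (fine Lc M) n)) × Fin (d + 1)) ℝ) := by
  -- the record's `Q₂₁` IS `stepIns₁` along the scaled transported direction
  have e : (∑ a' : ↥(pbox (fine Lc M)) × Fin (d + 1),
      ((c * (((Lc : ℝ) ^ (d + 1) * stepScale d Lc (lev 1)) * (∏ i ∈ range n, (stepScale d Lc (lev (i + 1 + 1)) * ((box (d + 1) Lc).card : ℝ)))⁻¹))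
        * (compRows Lc (fine Lc M) (fun k => lev (k + 1)) (fun k => rs (k + 1)) n *ᵥ w) a') •
      (perF (fine Lc M) (dper (fine Lc M) (vhSAt (toSite (rs 1)) d Lc rfl a'.2 (a'.1 : Site (d + 1))))).submatrix
        (fun a : ↥(pbox M) × Fin (d + 1) => ((coarsePt M Lc a.1, Sum.inr a.2) : Idx (fine Lc M) (Fib d)))
        (fun b : ↥(pbox (fine Lc M)) × Fin (d + 1) => ((b.1, Sum.inl b.2) : Idx (fine Lc M) (Fib d))))
      = stepIns₁ M Lc (rs 1) ((c * (((Lc : ℝ) ^ (d + 1) * stepScale d Lc (lev 1)) * (∏ i ∈ range n, (stepScale d Lc (lev (i + 1 + 1)) * ((box (d + 1) Lc).card : ℝ)))⁻¹))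
          • (compRows Lc (fine Lc M) (fun k => lev (k + 1)) (fun k => rs (k + 1)) n *ᵥ w)) := by
    simp only [stepIns₁, Pi.smul_apply, smul_eq_mul]
  rw [e, stepIns₁_smul, Matrix.smul_mul, Matrix.mul_smul]
  -- the right-hand side, top-peeled (`compIns₁_succ` is `rfl`), spelled over the lower tower
  show _ = c • ((((Lc : ℝ) ^ (d + 1) * stepScale d Lc (lev 1)) * (∏ i ∈ range n, (stepScale d Lc (lev (i + 1 + 1)) * ((box (d + 1) Lc).card : ℝ)))⁻¹) •
        (stepIns₁ M Lc (rs 1) ((compRows Lc (fine Lc M) (fun k => lev (k + 1)) (fun k => rs (k + 1)) n) *ᵥ w)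
          * compRows Lc (fine Lc M) (fun k => lev (k + 1)) (fun k => rs (k + 1)) n)
      + Qstep Lc M (lev 1) (rs 1) * compIns₁ Lc (fine Lc M) (fun k => lev (k + 1)) (fun k => rs (k + 1)) n w)
  rw [smul_add, smul_smul]

/-! ## §2 Order 2: the symmetrised `𝔔₂f` is `c² • compIns₂₂` one storey up -/

/-- [folklore] **ORDER 2 — `½ • (𝔔₂f v v′ + 𝔔₂f v′ v)` IS `c² • compIns₂₂` ONE STOREY UP** (#21's `𝔔₂f v v′ = Q₂₂f v v′ * Q₁₀ + Q₂₁f v * Q₁₁f v′ + (Q₂₁f v * Q₁₁f v′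
+ Q₂₀ * Q₁₂f v v′)` is the «`v` on top twice» half; #42a's `hQN₂` binds its symmetrisation): with the record's `Q₂₂` (unit `(Lc^{d+1}·stepScale d Lc (lev 1))⁻¹`, weights
`(cθ_n) • (compRows′ *ᵥ ·)`, the ½-symmetrised relative period sum of `vh₂SAt` = OUR `stepIns₂₂`), `Q₂₁` as in §1, `Q₁₁ w := c • compIns₁′ w`, `Q₁₂ w w′ := c² • compIns₂₂′ w w′`:
`½ • (𝔔₂(w, w′) + 𝔔₂(w′, w)) = c² • compIns₂₂ Lc M lev rs (n+1) w w′` (`compIns₂₂_succ`; the unit identity `(Lc^{d+1}s)⁻¹·(cθ)² = c²·θ∕σ`; `stepIns₂₂_comm`, `compIns₂₂_comm`). -/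
theorem nestedQ₂_symm_eq_smul_compIns₂₂ (n : ℕ) (M : Fin (d + 1) → ℕ) [∀ μ, NeZero (M μ)] (lev : ℕ → ℕ) (rs : ℕ → (Fin (d + 1) → ℕ))
    (hrs : ∀ k, rs k ∈ box (d + 1) Lc) (c : ℝ)
    (Q₂₁ : (↥(pbox (towerTorus Lc (fine Lc M) n)) × Fin (d + 1) → ℝ) → Matrix (↥(pbox M) × Fin (d + 1)) (↥(pbox (fine Lc M)) × Fin (d + 1)) ℝ)
    (hQ₂₁ : ∀ w, Q₂₁ w = ∑ a' : ↥(pbox (fine Lc M)) × Fin (d + 1),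
        ((c * (((Lc : ℝ) ^ (d + 1) * stepScale d Lc (lev 1)) * (∏ i ∈ range n, (stepScale d Lc (lev (i + 1 + 1)) * ((box (d + 1) Lc).card : ℝ)))⁻¹))
          * (compRows Lc (fine Lc M) (fun k => lev (k + 1)) (fun k => rs (k + 1)) n *ᵥ w) a') •
        (perF (fine Lc M) (dper (fine Lc M) (vhSAt (toSite (rs 1)) d Lc rfl a'.2 (a'.1 : Site (d + 1))))).submatrix
          (fun a : ↥(pbox M) × Fin (d + 1) => ((coarsePt M Lc a.1, Sum.inr a.2) : Idx (fine Lc M) (Fib d)))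
          (fun b : ↥(pbox (fine Lc M)) × Fin (d + 1) => ((b.1, Sum.inl b.2) : Idx (fine Lc M) (Fib d))))
    (Q₂₂ : (↥(pbox (towerTorus Lc (fine Lc M) n)) × Fin (d + 1) → ℝ) → (↥(pbox (towerTorus Lc (fine Lc M) n)) × Fin (d + 1) → ℝ) →
      Matrix (↥(pbox M) × Fin (d + 1)) (↥(pbox (fine Lc M)) × Fin (d + 1)) ℝ)
    (hQ₂₂ : ∀ w w', Q₂₂ w w' = ((Lc : ℝ) ^ (d + 1) * stepScale d Lc (lev 1))⁻¹ •
        ∑ b : ↥(pbox (fine Lc M)) × Fin (d + 1), ∑ b' : ↥(pbox (fine Lc M)) × Fin (d + 1),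
          (((c * (((Lc : ℝ) ^ (d + 1) * stepScale d Lc (lev 1)) * (∏ i ∈ range n, (stepScale d Lc (lev (i + 1 + 1)) * ((box (d + 1) Lc).card : ℝ)))⁻¹))
              * (compRows Lc (fine Lc M) (fun k => lev (k + 1)) (fun k => rs (k + 1)) n *ᵥ w) b)
            * ((c * (((Lc : ℝ) ^ (d + 1) * stepScale d Lc (lev 1)) * (∏ i ∈ range n, (stepScale d Lc (lev (i + 1 + 1)) * ((box (d + 1) Lc).card : ℝ)))⁻¹))
              * (compRows Lc (fine Lc M) (fun k => lev (k + 1)) (fun k => rs (k + 1)) n *ᵥ w') b')) •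
          (perF (fine Lc M) (dper (fine Lc M) (fun x z a e => ∑' m : Site (d + 1), (1 / 2 : ℝ) *
            (vh₂SAt (toSite (rs 1)) Lc b.2 (b.1 : Site (d + 1)) b'.2 (translate (fine Lc M) (b'.1 : Site (d + 1)) m) x z a e
              + vh₂SAt (toSite (rs 1)) Lc b'.2 (translate (fine Lc M) (b'.1 : Site (d + 1)) m) b.2 (b.1 : Site (d + 1)) x z a e)))).submatrix
            (fun a : ↥(pbox M) × Fin (d + 1) => ((coarsePt M Lc a.1, Sum.inr a.2) : Idx (fine Lc M) (Fib d)))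
            (fun e : ↥(pbox (fine Lc M)) × Fin (d + 1) => ((e.1, Sum.inl e.2) : Idx (fine Lc M) (Fib d))))
    (w w' : ↥(pbox (towerTorus Lc (fine Lc M) n)) × Fin (d + 1) → ℝ) :
    (1 / 2 : ℝ) • ((Q₂₂ w w' * compRows Lc (fine Lc M) (fun k => lev (k + 1)) (fun k => rs (k + 1)) n
          + Q₂₁ w * (c • compIns₁ Lc (fine Lc M) (fun k => lev (k + 1)) (fun k => rs (k + 1)) n w')
          + (Q₂₁ w * (c • compIns₁ Lc (fine Lc M) (fun k => lev (k + 1)) (fun k => rs (k + 1)) n w')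
            + Qstep Lc M (lev 1) (rs 1) * (c ^ 2 • compIns₂₂ Lc (fine Lc M) (fun k => lev (k + 1)) (fun k => rs (k + 1)) n w w')))
        + (Q₂₂ w' w * compRows Lc (fine Lc M) (fun k => lev (k + 1)) (fun k => rs (k + 1)) n
          + Q₂₁ w' * (c • compIns₁ Lc (fine Lc M) (fun k => lev (k + 1)) (fun k => rs (k + 1)) n w)
          + (Q₂₁ w' * (c • compIns₁ Lc (fine Lc M) (fun k => lev (k + 1)) (fun k => rs (k + 1)) n w)
            + Qstep Lc M (lev 1) (rs 1) * (c ^ 2 • compIns₂₂ Lc (fine Lc M) (fun k => lev (k + 1)) (fun k => rs (k + 1)) n w' w))))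
      = c ^ 2 • (compIns₂₂ Lc M lev rs (n + 1) w w' : Matrix (↥(pbox M) × Fin (d + 1)) (↥(pbox (towerTorus Lc (fine Lc M) n)) × Fin (d + 1)) ℝ) := by
  -- abbreviations for the scalars
  set L : ℝ := (Lc : ℝ) ^ (d + 1) * stepScale d Lc (lev 1) with hL
  set σ : ℝ := ∏ i ∈ range n, (stepScale d Lc (lev (i + 1 + 1)) * ((box (d + 1) Lc).card : ℝ)) with hσ
  have hL0 : L ≠ 0 := mul_ne_zero (pow_ne_zero _ (by exact_mod_cast NeZero.ne Lc)) (stepScale_ne_zero _)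
  set C := compRows Lc (fine Lc M) (fun k => lev (k + 1)) (fun k => rs (k + 1)) n with hC
  -- the record's `Q₂₁ ∕ Q₂₂` ARE `stepIns₁ ∕ stepIns₂₂` along the scaled transported directions
  have e₁ : ∀ v, Q₂₁ v = (c * (L * σ⁻¹)) • stepIns₁ M Lc (rs 1) (C *ᵥ v) := fun v => by
    rw [hQ₂₁, ← stepIns₁_smul]
    simp only [stepIns₁, Pi.smul_apply, smul_eq_mul]
  have e₂ : ∀ v v', Q₂₂ v v' = (L⁻¹ * ((c * (L * σ⁻¹)) * (c * (L * σ⁻¹)))) • stepIns₂₂ M Lc (rs 1) (C *ᵥ v) (C *ᵥ v') := fun v v' => by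
    rw [hQ₂₂, ← smul_smul, ← smul_smul, ← stepIns₂₂_smul_right, ← stepIns₂₂_smul_left]
    simp only [stepIns₂₂, Pi.smul_apply, smul_eq_mul]
  -- the record's unit: `L⁻¹ · (cθ)² = c² · (θ ∕ σ)`, `θ = L ∕ σ`
  have hunit : L⁻¹ * ((c * (L * σ⁻¹)) * (c * (L * σ⁻¹))) = c ^ 2 * ((L * σ⁻¹) * σ⁻¹) := by
    rw [show L⁻¹ * ((c * (L * σ⁻¹)) * (c * (L * σ⁻¹))) = c ^ 2 * ((L * σ⁻¹) * σ⁻¹) * (L⁻¹ * L) by ring, inv_mul_cancel₀ hL0, mul_one]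
  rw [e₁, e₁, e₂, e₂, hunit, stepIns₂₂_comm M Lc (hrs 1) (C *ᵥ w') (C *ᵥ w), compIns₂₂_comm Lc n (fine Lc M) _ _ (fun k => hrs (k + 1)) w' w]
  -- the right-hand side, top-peeled (`compIns₂₂_succ` is `rfl`), spelled over the lower tower
  show _ = c ^ 2 • (((L * σ⁻¹) * σ⁻¹) • (stepIns₂₂ M Lc (rs 1) (C *ᵥ w) (C *ᵥ w') * C)
      + (L * σ⁻¹) • (stepIns₁ M Lc (rs 1) (C *ᵥ w) * compIns₁ Lc (fine Lc M) (fun k => lev (k + 1)) (fun k => rs (k + 1)) n w'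
        + stepIns₁ M Lc (rs 1) (C *ᵥ w') * compIns₁ Lc (fine Lc M) (fun k => lev (k + 1)) (fun k => rs (k + 1)) n w)
      + Qstep Lc M (lev 1) (rs 1) * compIns₂₂ Lc (fine Lc M) (fun k => lev (k + 1)) (fun k => rs (k + 1)) n w w')
  simp only [Matrix.smul_mul, Matrix.mul_smul, smul_add, smul_smul]
  module

end Summit.QuantumFields.BalabanUV.Beta.FP.TorusCompositeNestedJets

end
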